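import Literature.Geometry.Symplectic.AxisGluingPrimitive
import Literature.Analysis.Matrix.BlockInterpolationBound
import HarnessLib

/-!
# Pointwise bounds for the gluing along an even zero circle

Topic `Geometry/Symplectic`; namespace `Literature.Geometry.Symplectic`.  Theorems only; no named
fact, no `sorry`.  Elementary inequalities feeding the positivity estimate of the glued form
`ω' = ω + d(ρ · η)` (Perutz 2006, proof of Lemma 3.1):

* `exists_bound_periodic_matrix` — a continuous periodic matrix family is entrywise bounded;
* `sum_sq_normalPart`, `abs_normalPart_le`, `sum_abs_normalPart_le` — the normal coordinates
  against the distance `|x|` to the axis;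
* `norm_betaForm_interpolation_le` — `‖β((1−t)M + tD) x‖ ≤ C_Ω |x|`;
* `extDeriv_smul_oneForm` — the Leibniz rule `d(ρ η) = ρ dη + dρ ∧ η` for a function `ρ` and a
  `1`-form `η`, with the wedge term `E = Alt(dρ ⊗ η)`, and its size `‖E‖ ≤ 2 ‖dρ‖ ‖η‖`
  (`norm_wedgeTerm_le`).

## References

* T. Perutz, *Zero-sets of near-symplectic forms*, J. Symplectic Geom. 4 (2006), §3 (proof of
  Lemma 3.1). [Perutz2006]
-/

noncomputable section

open scoped Manifold ContDiff Topology Real Matrix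
open Set Function Filter Metric Real Matrix Literature.Analysis.Matrix

namespace Literature.Geometry.Symplectic

/-! ### Bounded periodic matrix families -/

/-- **A continuous periodic matrix family is entrywise bounded.** [folklore] -/
theorem exists_bound_periodic_matrix {M : ℝ → Matrix (Fin 3) (Fin 3) ℝ}
    (hMc : ∀ i j, Continuous fun θ ↦ M θ i j) {P : ℝ} (hP : 0 < P) (hMP : ∀ θ, M (θ + P) = M θ) :
    ∃ B : ℝ, 0 ≤ B ∧ ∀ θ i j, |M θ i j| ≤ B := by
  set g : ℝ → ℝ := fun θ ↦ ∑ i, ∑ j, |M θ i j| with hg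
  have hgc : Continuous g :=
    continuous_finsetSum _ fun i _ ↦ continuous_finsetSum _ fun j _ ↦ (hMc i j).abs
  have hgp : Function.Periodic g P := fun θ ↦ by simp only [hg, hMP]
  obtain ⟨B, hB⟩ := (isCompact_Icc (a := (0 : ℝ)) (b := P)).exists_bound_of_continuousOn
    hgc.continuousOn
  have hle : ∀ θ i j, |M θ i j| ≤ g θ := fun θ i j ↦ by
    have h1 : |M θ i j| ≤ ∑ j', |M θ i j'| :=
      Finset.single_le_sum (fun j' _ ↦ abs_nonneg (M θ i j')) (Finset.mem_univ j)
    exact h1.trans (Finset.single_le_sum (fun i' _ ↦ Finset.sum_nonneg fun j' _ ↦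
      abs_nonneg (M θ i' j')) (Finset.mem_univ i))
  refine ⟨max B 0, le_max_right _ _, fun θ i j ↦ ?_⟩
  set k : ℤ := toIcoDiv hP 0 θ with hk
  have hθ' : θ - k • P ∈ Icc 0 P := by
    have h := sub_toIcoDiv_zsmul_mem_Ico hP 0 θ
    rw [zero_add] at h
    exact ⟨h.1, h.2.le⟩
  have hgθ : g θ = g (θ - k • P) := (hgp.sub_zsmul_eq k).symm
  have hb := hB _ hθ'
  rw [Real.norm_eq_abs, abs_of_nonneg (Finset.sum_nonneg fun i _ ↦ Finset.sum_nonneg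
    fun j _ ↦ abs_nonneg _)] at hb
  exact ((hle θ i j).trans (hgθ.le.trans hb)).trans (le_max_left _ _)

/-! ### Normal coordinates against the distance to the axis -/

/-- `Σ xₖ² = |x|²`. [folklore] -/
theorem sum_sq_normalPart (q : EuclideanSpace ℝ (Fin 4)) :
    ∑ k, normalPart q k ^ 2 = ‖q - hondaAxisPoint (q 0)‖ ^ 2 := by
  rw [norm_sub_hondaAxisPoint_sq]
  simp [Fin.sum_univ_three, normalPart_apply]

/-- `|xₖ| ≤ |x|`. [folklore] -/
theorem abs_normalPart_le (q : EuclideanSpace ℝ (Fin 4)) (k : Fin 3) :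
    |normalPart q k| ≤ ‖q - hondaAxisPoint (q 0)‖ := by
  refine abs_le_of_sq_le_sq ?_ (norm_nonneg _)
  rw [← sum_sq_normalPart]
  exact Finset.single_le_sum (fun j _ ↦ sq_nonneg (normalPart q j)) (Finset.mem_univ k)

/-- `Σ |xₖ| ≤ 3 |x|`. [folklore] -/
theorem sum_abs_normalPart_le (q : EuclideanSpace ℝ (Fin 4)) :
    ∑ k, |normalPart q k| ≤ 3 * ‖q - hondaAxisPoint (q 0)‖ := by
  have h := fun k ↦ abs_normalPart_le q k
  simp only [Fin.sum_univ_three]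
  linarith [h 0, h 1, h 2]

/-! ### The main term `β(A x)` of the interpolation -/

/-- Entries of the interpolant `A = (1 − t) M + t D` are bounded by `B + 2`. [folklore] -/
theorem abs_interpolation_entry_le {Mθ : Matrix (Fin 3) (Fin 3) ℝ} {B : ℝ}
    (hB : ∀ i j, |Mθ i j| ≤ B) {t : ℝ} (ht : t ∈ Icc (0 : ℝ) 1) (i j : Fin 3) :
    |((1 - t) • Mθ + t • Matrix.diagonal ![(1 : ℝ), 1, -2]) i j| ≤ B + 2 := by
  have hD : |Matrix.diagonal ![(1 : ℝ), 1, -2] i j| ≤ 2 := by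
    by_cases hij : i = j
    · subst hij; fin_cases i <;> simp [Matrix.diagonal]
    · simp [Matrix.diagonal_apply_ne _ hij]
  rw [Matrix.add_apply, Matrix.smul_apply, Matrix.smul_apply, smul_eq_mul, smul_eq_mul]
  refine (abs_add_le _ _).trans ?_
  rw [abs_mul, abs_mul, abs_of_nonneg (by linarith [ht.2] : (0 : ℝ) ≤ 1 - t), abs_of_nonneg ht.1]
  have h1 : (1 - t) * |Mθ i j| ≤ (1 - t) * B := mul_le_mul_of_nonneg_left (hB i j) (by linarith [ht.2])
  have h2 : t * |Matrix.diagonal ![(1 : ℝ), 1, -2] i j| ≤ t * 2 := mul_le_mul_of_nonneg_left hD ht.1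
  have hB0 : 0 ≤ B := (abs_nonneg _).trans (hB 0 0)
  nlinarith [ht.1, ht.2]

/-- **`Σₖ |(A x)ₖ| ≤ 9 (B + 2) |x|`** for the interpolant. [folklore] -/
theorem sum_abs_interpolation_mulVec_le {Mθ : Matrix (Fin 3) (Fin 3) ℝ} {B : ℝ}
    (hB : ∀ i j, |Mθ i j| ≤ B) {t : ℝ} (ht : t ∈ Icc (0 : ℝ) 1) (q : EuclideanSpace ℝ (Fin 4)) :
    ∑ k, |(((1 - t) • Mθ + t • Matrix.diagonal ![(1 : ℝ), 1, -2]) *ᵥ normalPart q) k| ≤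
      9 * (B + 2) * ‖q - hondaAxisPoint (q 0)‖ := by
  set A := (1 - t) • Mθ + t • Matrix.diagonal ![(1 : ℝ), 1, -2] with hA
  have hrow : ∀ k, |(A *ᵥ normalPart q) k| ≤ (B + 2) * ∑ j, |normalPart q j| := by
    intro k
    rw [Matrix.mulVec, dotProduct, Finset.mul_sum]
    refine (Finset.abs_sum_le_sum_abs _ _).trans (Finset.sum_le_sum fun j _ ↦ ?_)
    rw [abs_mul]
    exact mul_le_mul_of_nonneg_right (abs_interpolation_entry_le hB ht k j) (abs_nonneg _)
  have hs := sum_abs_normalPart_le q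
  have hB0 : 0 ≤ B := (abs_nonneg _).trans (hB 0 0)
  calc ∑ k, |(A *ᵥ normalPart q) k| ≤ ∑ _k : Fin 3, (B + 2) * ∑ j, |normalPart q j| :=
        Finset.sum_le_sum fun k _ ↦ hrow k
    _ = 3 * ((B + 2) * ∑ j, |normalPart q j|) := by simp [Finset.sum_const]
    _ ≤ 3 * ((B + 2) * (3 * ‖q - hondaAxisPoint (q 0)‖)) := by
        have : 0 ≤ B + 2 := by linarith
        nlinarith
    _ = 9 * (B + 2) * ‖q - hondaAxisPoint (q 0)‖ := by ring

/-- **`‖β(A x)‖ ≤ C_Ω |x|`**, `C_Ω = 9 (‖β₁‖ + ‖β₂‖ + ‖β₃‖)(B + 2)`. [folklore] -/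
theorem norm_betaForm_interpolation_le {Mθ : Matrix (Fin 3) (Fin 3) ℝ} {B : ℝ}
    (hB : ∀ i j, |Mθ i j| ≤ B) {t : ℝ} (ht : t ∈ Icc (0 : ℝ) 1) (q : EuclideanSpace ℝ (Fin 4)) :
    ‖betaForm (((1 - t) • Mθ + t • Matrix.diagonal ![(1 : ℝ), 1, -2]) *ᵥ normalPart q)‖ ≤
      9 * (‖hondaBeta₁‖ + ‖hondaBeta₂‖ + ‖hondaBeta₃‖) * (B + 2) * ‖q - hondaAxisPoint (q 0)‖ := by
  have h1 := norm_betaForm_le (((1 - t) • Mθ + t • Matrix.diagonal ![(1 : ℝ), 1, -2]) *ᵥ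
    normalPart q)
  have h2 := sum_abs_interpolation_mulVec_le hB ht q
  have hβ : 0 ≤ ‖hondaBeta₁‖ + ‖hondaBeta₂‖ + ‖hondaBeta₃‖ := by positivity
  calc _ ≤ (‖hondaBeta₁‖ + ‖hondaBeta₂‖ + ‖hondaBeta₃‖) * ∑ k, |(((1 - t) • Mθ +
        t • Matrix.diagonal ![(1 : ℝ), 1, -2]) *ᵥ normalPart q) k| := h1
    _ ≤ (‖hondaBeta₁‖ + ‖hondaBeta₂‖ + ‖hondaBeta₃‖) * (9 * (B + 2) * ‖q - hondaAxisPoint (q 0)‖) :=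
        mul_le_mul_of_nonneg_left h2 hβ
    _ = _ := by ring

/-- **Linearity of the main term**: `(1 − t) β(M x) + t β(D x) = β(((1 − t) M + t D) x)`.
[folklore] -/
theorem betaForm_interpolation (Mθ : Matrix (Fin 3) (Fin 3) ℝ) (t : ℝ) (x : Fin 3 → ℝ) :
    (1 - t) • betaForm (Mθ *ᵥ x) + t • betaForm (Matrix.diagonal ![(1 : ℝ), 1, -2] *ᵥ x) =
      betaForm (((1 - t) • Mθ + t • Matrix.diagonal ![(1 : ℝ), 1, -2]) *ᵥ x) := by
  rw [Matrix.add_mulVec, Matrix.smul_mulVec, Matrix.smul_mulVec, betaForm_add, betaForm_smul,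
    betaForm_smul]

/-! ### The Leibniz rule `d(ρ η) = ρ dη + dρ ∧ η` -/

/-- **Leibniz rule for a function times a `1`-form**:
`d(ρ η)(x) = ρ(x) dη(x) + Alt(dρ(x) ⊗ η(x))`. [folklore] -/
theorem extDeriv_smul_oneForm {ρ : EuclideanSpace ℝ (Fin 4) → ℝ}
    {η : EuclideanSpace ℝ (Fin 4) → (EuclideanSpace ℝ (Fin 4)) [⋀^Fin 1]→L[ℝ] ℝ}
    {x : EuclideanSpace ℝ (Fin 4)} (hρ : DifferentiableAt ℝ ρ x) (hη : DifferentiableAt ℝ η x) :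
    extDeriv (fun y ↦ ρ y • η y) x =
      ρ x • extDeriv η x +
        ContinuousAlternatingMap.alternatizeUncurryFin ((fderiv ℝ ρ x).smulRight (η x)) := by
  rw [extDeriv, extDeriv, fderiv_fun_smul hρ hη, ContinuousAlternatingMap.alternatizeUncurryFin_add,
    ContinuousAlternatingMap.alternatizeUncurryFin_smul]

/-- **Size of the wedge term**: `‖Alt(dρ ⊗ η)‖ ≤ 2 ‖dρ‖ ‖η‖`. [folklore] -/
theorem norm_wedgeTerm_le (φ : EuclideanSpace ℝ (Fin 4) →L[ℝ] ℝ)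
    (e : (EuclideanSpace ℝ (Fin 4)) [⋀^Fin 1]→L[ℝ] ℝ) :
    ‖ContinuousAlternatingMap.alternatizeUncurryFin (φ.smulRight e)‖ ≤ 2 * ‖φ‖ * ‖e‖ := by
  have h := ContinuousAlternatingMap.norm_alternatizeUncurryFin_le (φ.smulRight e)
  rw [ContinuousLinearMap.norm_smulRight_apply] at h
  norm_num at h
  linarith

/-- Where `dρ = 0` the wedge term vanishes. [folklore] -/
theorem wedgeTerm_eq_zero_of_fderiv_eq_zero {ρ : EuclideanSpace ℝ (Fin 4) → ℝ}
    {x : EuclideanSpace ℝ (Fin 4)} (h : fderiv ℝ ρ x = 0)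
    (e : (EuclideanSpace ℝ (Fin 4)) [⋀^Fin 1]→L[ℝ] ℝ) :
    ContinuousAlternatingMap.alternatizeUncurryFin ((fderiv ℝ ρ x).smulRight e) = 0 := by
  rw [h]
  have h0 : (0 : EuclideanSpace ℝ (Fin 4) →L[ℝ] ℝ).smulRight e = 0 := by
    ext v w; simp
  rw [h0, ← ContinuousAlternatingMap.alternatizeUncurryFinCLM_apply, map_zero]

end Literature.Geometry.Symplectic

end
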